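import Mathlib
import Summits.NavierStokesRegularity.NavierStokesRegularity.Theorems.LevelSetModerationHighSpeedPressureWorkFastSetGradientLogFreeUnit

/-!
# Route LevelSetModeration — `HighSpeedPressureWork`: the LOG-FREE fast-set bound and the clean speed-gradient law at margin zero

Support file for item stmt-NavierStokesRegularity-18149 (`HighSpeedPressureWork`), stub
`stub_earlyBookkeeping` (margin zero). Scaling of the log-free unit theorem
(`levelSetModeration_fastSetGradient_logFree_unit`, `…FastSetGradientLogFreeUnit.lean`) to
general viscosity and speed bound, its specialisation to the data class of the crux in the early
window, and the corollary that closes the `νD_c` part of the early stub at margin zero: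

* `levelSetModeration_fastSetGradient_logFree_of_speed_le` — speed `≤ G` on `[0,T']`, datum
  `≤ G/2`: `‖∇‖u(t,·)‖(x)‖ ≤ A G²/ν` whenever `‖u(t,x)‖ > G/2`, `0 < t ≤ εν/G²`;
* `levelSetModeration_fastSetGradient_logFree` — the data class: `ν‖∇‖u(τ,·)‖(x)‖ ≤ A B₀²`
  on `{‖u(τ)‖ > B₀}` for `τ ≤ εν/B₀²` (early window `|u| ≤ 2B₀`, `G = 2B₀`);
* `levelSetModeration_fastSetDissipation_le` — the CLEAN level-set dissipation law at margin zero
  in the early window: for `c ≥ B₀`, `t ≤ min T (εν/B₀²)`,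
  `∫₀ᵗ∫ 1_{‖u‖>c} ‖∇‖u‖‖² ≤ (A B₀²/ν)² ∫₀ᵗ vol{‖u(τ)‖ > c} dτ`, i.e. `ν² D_c(t) ≤ A² B₀⁴ V_c(t)` —
  the speed-gradient law that the crux implies (`highSpeedPressureWork_speedGradientLaw`), now a
  THEOREM at margin zero for early times, with no logarithm.
-/

noncomputable section

-- single-conjunct summit: `Summit.<Summit>.<Problem>` repeats the name by the D-0017 layout
set_option linter.dupNamespace false

namespace Summit.NavierStokesRegularity.NavierStokesRegularity.Theorems

open MeasureTheory Set Filter Topology Function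
open scoped ENNReal RealInnerProductSpace
open Literature.Analysis.FluidPDE
open Literature.Analysis.UnboundedOperators (heatExtension heatKernel heatExtension_apply
  heatKernel_pos integrable_heatKernel_holds integral_heatKernel_eq_one_holds
  integrable_heatKernel_smul_of_bound norm_fderiv_heatExtension_le_mul_sqrt_log
  contDiff_heatExtension_holds memLp_top_of_continuous_of_bound)

/-! ### General viscosity and speed bound: the scale-invariant form -/

/-- **Log-free fast-set speed-gradient bound under a speed bound (scale-invariant form).** There
are absolute `A ≥ 0`, `ε > 0` such that: for `ν > 0`, `G > 0`, every classical solution with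
viscosity `ν` on `ℝ³ × [0, T)` bounded by `G` on `[0, T'] × ℝ³` (`T' < T`), with slices uniformly
in `L²` there, and with `‖u(0,·)‖ ≤ G/2`, satisfies, at every `t ∈ (0, T')` with `t ≤ ε ν/G²` and
every point `x` with `‖u(t,x)‖ > G/2`: `‖∇‖u(t,·)‖(x)‖ ≤ A G²/ν`
(scaling `u ↦ G⁻¹u(νt/G², νx/G)` of `levelSetModeration_fastSetGradient_logFree_unit`). [folklore] -/
theorem levelSetModeration_fastSetGradient_logFree_of_speed_le :
    ∃ A ε : ℝ, 0 ≤ A ∧ 0 < ε ∧ ∀ {ν T T' G : ℝ}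
      {u : ℝ → EuclideanSpace ℝ (Fin 3) → EuclideanSpace ℝ (Fin 3)}
      {p : ℝ → EuclideanSpace ℝ (Fin 3) → ℝ}, 0 < ν → 0 < G →
      IsClassicalNSSolutionOn (Ico 0 T) ν 0 u p → 0 < T' → T' < T →
      (∀ t ∈ Icc 0 T', ∀ x, ‖u t x‖ ≤ G) → ∀ {K : ℝ≥0∞}, K ≠ ∞ →
      (∀ t ∈ Icc 0 T', eLpNorm (u t) 2 volume ≤ K) → (∀ x, ‖u 0 x‖ ≤ G / 2) →
      ∀ t ∈ Ioo 0 T', t ≤ ε * ν / G ^ 2 → ∀ x, G / 2 < ‖u t x‖ →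
        ‖fderiv ℝ (fun y => ‖u t y‖) x‖ ≤ A * (G ^ 2 / ν) := by
  obtain ⟨A, ε, hA0, hε, hunit⟩ := levelSetModeration_fastSetGradient_logFree_unit
  refine ⟨A, ε, hA0, hε, ?_⟩
  intro ν T T' G u p hν hG hcl hT' hT'T hbd K hK hL2 hB0 t ht htε x hfast
  -- scaling parameters
  set α : ℝ := G⁻¹ with hα
  set γ : ℝ := ν / G with hγ
  set β : ℝ := ν / G ^ 2 with hβ
  have hαpos : 0 < α := by rw [hα]; positivity
  have hγpos : 0 < γ := by rw [hγ]; positivity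
  have hβpos : 0 < β := by rw [hβ]; positivity
  have hβαγ : β = α * γ := by rw [hβ, hα, hγ]; field_simp
  have hcl' := hcl.stRescale hαpos hγpos hβαγ 0 0
  have hS : ((fun r => (0 : ℝ) + β * r) ⁻¹' Ico 0 T) = Ico 0 (T / β) := by
    ext r
    simp only [mem_preimage, mem_Ico, zero_add]
    constructor
    · rintro ⟨h1, h2⟩
      exact ⟨nonneg_of_mul_nonneg_right h1 hβpos, (lt_div_iff₀' hβpos).2 h2⟩
    · rintro ⟨h1, h2⟩
      exact ⟨mul_nonneg hβpos.le h1, (lt_div_iff₀' hβpos).1 h2⟩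
  have hν1 : α * ν / γ = 1 := by rw [hα, hγ]; field_simp
  rw [hS, hν1, smul_stPull_zero] at hcl'
  set w : ℝ → EuclideanSpace ℝ (Fin 3) → EuclideanSpace ℝ (Fin 3) := α • stPull β γ 0 0 u with hw
  have hwapp : ∀ s y, w s y = α • u (β * s) (γ • y) := by
    intro s y
    simp only [hw, Pi.smul_apply, stPull_apply, zero_add]
  have hT'β : 0 < T' / β := div_pos hT' hβpos
  have hT'βT : T' / β < T / β := div_lt_div_of_pos_right hT'T hβpos
  have hmemI : ∀ {s : ℝ}, s ∈ Icc 0 (T' / β) → β * s ∈ Icc 0 T' := by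
    intro s hs
    refine ⟨mul_nonneg hβpos.le hs.1, ?_⟩
    have := hs.2
    rwa [le_div_iff₀' hβpos] at this
  have hbd' : ∀ s ∈ Icc 0 (T' / β), ∀ y, ‖w s y‖ ≤ 1 := by
    intro s hs y
    rw [hwapp, norm_smul, Real.norm_of_nonneg hαpos.le, hα]
    have := hbd (β * s) (hmemI hs) (γ • y)
    calc G⁻¹ * ‖u (β * s) (γ • y)‖ ≤ G⁻¹ * G := by gcongr
      _ = 1 := inv_mul_cancel₀ hG.ne'
  set K' : ℝ≥0∞ := ENNReal.ofReal |α| * (ENNReal.ofReal (γ ^ 3)⁻¹) ^ (1 / 2 : ℝ) * K with hK'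
  have hK'top : K' ≠ ∞ := by
    refine ENNReal.mul_ne_top (ENNReal.mul_ne_top ENNReal.ofReal_ne_top ?_) hK
    exact ENNReal.rpow_ne_top_of_nonneg (by norm_num) ENNReal.ofReal_ne_top
  have hL2' : ∀ s ∈ Icc 0 (T' / β), eLpNorm (w s) 2 volume ≤ K' := by
    intro s hs
    have h1 : w s = fun y => α • u (β * s) ((0 : EuclideanSpace ℝ (Fin 3)) + γ • y) := by
      funext y; rw [hwapp, zero_add]
    rw [h1]
    refine (eLpNorm_two_smul_comp_affine_le α hγpos 0).trans ?_
    rw [hK']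
    gcongr
    exact hL2 (β * s) (hmemI hs)
  -- the datum bound `1/2`
  have hB0' : ∀ y, ‖w 0 y‖ ≤ 1 / 2 := by
    intro y
    rw [hwapp, mul_zero, norm_smul, Real.norm_of_nonneg hαpos.le, hα]
    calc G⁻¹ * ‖u 0 (γ • y)‖ ≤ G⁻¹ * (G / 2) := mul_le_mul_of_nonneg_left (hB0 _) hαpos.le
      _ = 1 / 2 := by field_simp
  -- the rescaled time, window and fastness
  have htβ : t / β ∈ Ioo 0 (T' / β) := ⟨div_pos ht.1 hβpos, div_lt_div_of_pos_right ht.2 hβpos⟩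
  have hwin : t / β ≤ ε := by
    rw [div_le_iff₀ hβpos, hβ]
    refine htε.trans (le_of_eq ?_)
    field_simp
  have hhalf : 0 < (1 : ℝ) / 2 := by norm_num
  have hfast' : 1 / 2 < ‖w (t / β) (γ⁻¹ • x)‖ := by
    rw [hwapp, mul_div_cancel₀ _ hβpos.ne', smul_smul, mul_inv_cancel₀ hγpos.ne', one_smul,
      norm_smul, Real.norm_of_nonneg hαpos.le, hα]
    have h1 : G⁻¹ * (G / 2) < G⁻¹ * ‖u t x‖ := mul_lt_mul_of_pos_left hfast (inv_pos.2 hG)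
    have h2 : G⁻¹ * (G / 2) = 1 / 2 := by field_simp
    rwa [h2] at h1
  have key := hunit hcl' hT'β hT'βT hbd' hK'top hL2' hB0' (t / β) htβ hwin (γ⁻¹ • x) hfast'
  -- undo the scaling: `‖u t ·‖ = α⁻¹ ‖w (t/β) (γ⁻¹ • ·)‖`
  set W : EuclideanSpace ℝ (Fin 3) → ℝ := fun y => ‖w (t / β) y‖ with hW
  have hNW : (fun y => ‖u t y‖) = fun y => α⁻¹ * W (γ⁻¹ • y) := by
    funext y
    rw [hW]
    dsimp only
    rw [hwapp, mul_div_cancel₀ _ hβpos.ne', smul_smul, mul_inv_cancel₀ hγpos.ne', one_smul,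
      norm_smul, Real.norm_of_nonneg hαpos.le, ← mul_assoc, inv_mul_cancel₀ hαpos.ne', one_mul]
  -- differentiability of `W` at `γ⁻¹ • x`
  have hwt : Differentiable ℝ (w (t / β)) :=
    (hcl'.contDiff_velocity ⟨htβ.1.le, htβ.2.trans hT'βT⟩).differentiable (by simp)
  have hwx : w (t / β) (γ⁻¹ • x) ≠ 0 := norm_pos_iff.1 (hhalf.trans hfast')
  have hWd : DifferentiableAt ℝ W (γ⁻¹ • x) := (hwt (γ⁻¹ • x)).norm ℝ hwx
  have hlin : HasFDerivAt (fun y : EuclideanSpace ℝ (Fin 3) => γ⁻¹ • y)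
      (γ⁻¹ • ContinuousLinearMap.id ℝ (EuclideanSpace ℝ (Fin 3))) x :=
    (hasFDerivAt_id x).const_smul γ⁻¹
  have hcomp : HasFDerivAt (fun y => α⁻¹ * W (γ⁻¹ • y))
      (α⁻¹ • ((fderiv ℝ W (γ⁻¹ • x)).comp
        (γ⁻¹ • ContinuousLinearMap.id ℝ (EuclideanSpace ℝ (Fin 3))))) x :=
    (hWd.hasFDerivAt.comp x hlin).const_mul α⁻¹
  rw [hNW, hcomp.fderiv]
  -- norms
  have hn : ‖α⁻¹ • ((fderiv ℝ W (γ⁻¹ • x)).comp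
      (γ⁻¹ • ContinuousLinearMap.id ℝ (EuclideanSpace ℝ (Fin 3))))‖ ≤
      α⁻¹ * (‖fderiv ℝ W (γ⁻¹ • x)‖ * γ⁻¹) := by
    rw [norm_smul, Real.norm_of_nonneg (inv_pos.2 hαpos).le]
    refine mul_le_mul_of_nonneg_left ?_ (inv_pos.2 hαpos).le
    refine (ContinuousLinearMap.opNorm_comp_le _ _).trans ?_
    refine mul_le_mul_of_nonneg_left ?_ (norm_nonneg _)
    rw [norm_smul, Real.norm_of_nonneg (inv_pos.2 hγpos).le]
    calc γ⁻¹ * ‖ContinuousLinearMap.id ℝ (EuclideanSpace ℝ (Fin 3))‖ ≤ γ⁻¹ * 1 :=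
          mul_le_mul_of_nonneg_left ContinuousLinearMap.norm_id_le (inv_pos.2 hγpos).le
      _ = γ⁻¹ := mul_one _
  refine hn.trans ?_
  rw [hW] at key
  have hαγ : α⁻¹ * γ⁻¹ = G ^ 2 / ν := by rw [hα, hγ]; field_simp
  calc α⁻¹ * (‖fderiv ℝ W (γ⁻¹ • x)‖ * γ⁻¹) = α⁻¹ * γ⁻¹ * ‖fderiv ℝ W (γ⁻¹ • x)‖ := by ring
    _ ≤ α⁻¹ * γ⁻¹ * A := mul_le_mul_of_nonneg_left key (by positivity)
    _ = A * (G ^ 2 / ν) := by rw [hαγ]; ring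

/-! ### The data class of the crux: the early window -/

/-- **Log-free fast-set speed-gradient bound at margin zero for the data class of the crux.**
There are absolute `A ≥ 0` and `ε > 0` such that every classical solution of the unforced
Navier–Stokes system on `ℝ³ × [0,T)` (`ν, T > 0`) that is Leray–Hopf from a rapidly decaying
datum with `‖u(0,·)‖ ≤ B₀` (`B₀ > 0`) satisfies, at every time `τ ∈ (0, T)` with `τ ≤ ε ν/B₀²`
and every point `x` of the fast set `{‖u(τ)‖ > B₀}` (margin zero):

  `‖∇‖u(τ,·)‖(x)‖ ≤ A B₀²/ν`

(speed `≤ 2B₀` in the early window, `levelSetModeration_earlyWindow`; `G = 2B₀`). On the fast set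
at margin zero the speed gradient is bounded by the Kolmogorov-type scale `B₀²/ν`, against the
parabolic rate `B₀/√(ντ)` of the full gradient. [folklore] -/
theorem levelSetModeration_fastSetGradient_logFree :
    ∃ A ε : ℝ, 0 ≤ A ∧ 0 < ε ∧ ∀ (ν T : ℝ) (u : ℝ → EuclideanSpace ℝ (Fin 3) → EuclideanSpace ℝ (Fin 3)) (p : ℝ → EuclideanSpace ℝ (Fin 3) → ℝ), 0 < ν → 0 < T → Literature.Analysis.FluidPDE.IsClassicalNSSolutionOn (Set.Ico 0 T) ν 0 u p → Literature.Analysis.FluidPDE.IsLerayHopfOn T ν 0 (u 0) u → Literature.Analysis.FluidPDE.HasRapidSpatialDecay (u 0) → ∀ B₀ : ℝ, 0 < B₀ → (∀ x, ‖u 0 x‖ ≤ B₀) → ∀ τ ∈ Set.Ioo 0 T, τ ≤ ε * ν / B₀ ^ 2 → ∀ x, B₀ < ‖u τ x‖ → ‖fderiv ℝ (fun y => ‖u τ y‖) x‖ ≤ A * (B₀ ^ 2 / ν) := by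
  obtain ⟨c₀, hc₀, hW⟩ := levelSetModeration_earlyWindow
  obtain ⟨A, ε, hA0, hε, hG⟩ := levelSetModeration_fastSetGradient_logFree_of_speed_le
  refine ⟨4 * A, min (c₀ / 2) (ε / 4), by positivity, lt_min (by positivity) (by positivity), ?_⟩
  intro ν T u p hν hT hcl hLH hdec B₀ hB₀ hbd0 τ hτ hτε x hfast
  have hτ0 : 0 < τ := hτ.1
  -- the horizon `T' = (τ + T₁)/2`, `T₁ = min T (c₀ν/B₀²)`
  set T₁ : ℝ := min T (c₀ * ν / B₀ ^ 2) with hT₁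
  have hτc₀ : τ < c₀ * ν / B₀ ^ 2 := by
    have h1 : τ ≤ c₀ / 2 * ν / B₀ ^ 2 := hτε.trans
      (div_le_div_of_nonneg_right (mul_le_mul_of_nonneg_right (min_le_left _ _) hν.le)
        (by positivity))
    have h2 : c₀ / 2 * ν / B₀ ^ 2 < c₀ * ν / B₀ ^ 2 :=
      div_lt_div_of_pos_right (by nlinarith) (by positivity)
    exact h1.trans_lt h2
  have hτT₁ : τ < T₁ := lt_min hτ.2 hτc₀
  set T' : ℝ := (τ + T₁) / 2 with hT'
  have hτT' : τ < T' := by rw [hT']; linarith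
  have hT'T₁ : T' < T₁ := by rw [hT']; linarith
  have hT'pos : 0 < T' := hτ.1.trans hτT'
  have hT'T : T' < T := hT'T₁.trans_le (min_le_left _ _)
  have hT'c : T' < c₀ * ν / B₀ ^ 2 := hT'T₁.trans_le (min_le_right _ _)
  -- speed `≤ 2B₀` on `[0, T']`
  have hbd : ∀ s ∈ Icc 0 T', ∀ y, ‖u s y‖ ≤ 2 * B₀ := fun s hs y =>
    (hW ν T u p hν hT hcl hLH hdec B₀ hB₀ hbd0 s ⟨hs.1, hs.2.trans_lt hT'T⟩
      (hs.2.trans_lt hT'c)).1 y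
  -- uniform `L²` bound of the slices
  set KK : ℝ≥0∞ := (ENNReal.ofReal (∫ x, ‖u 0 x‖ ^ 2)) ^ (1 / 2 : ℝ) with hKK
  have hKKtop : KK ≠ ⊤ := ENNReal.rpow_ne_top_of_nonneg (by norm_num) ENNReal.ofReal_ne_top
  have hL2 : ∀ s ∈ Icc 0 T', eLpNorm (u s) 2 volume ≤ KK := by
    intro s hs
    have h := lintegral_enorm_sq_le_of_lerayHopf hLH hν.le ⟨hs.1, hs.2.trans hT'T.le⟩
    rw [eLpNorm_eq_lintegral_rpow_enorm_toReal (by norm_num) (by norm_num), ENNReal.toReal_ofNat,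
      hKK]
    refine ENNReal.rpow_le_rpow ?_ (by norm_num)
    refine le_trans (le_of_eq ?_) h
    exact lintegral_congr fun x => by rw [ENNReal.rpow_two]
  -- datum `≤ (2B₀)/2`, window `τ ≤ εν/(2B₀)²`, fastness `(2B₀)/2 < ‖u τ x‖`
  have hbd0' : ∀ y, ‖u 0 y‖ ≤ 2 * B₀ / 2 := fun y => (hbd0 y).trans (le_of_eq (by ring))
  have hτw : τ ≤ ε * ν / (2 * B₀) ^ 2 := by
    have h1 : τ ≤ ε / 4 * ν / B₀ ^ 2 := hτε.trans
      (div_le_div_of_nonneg_right (mul_le_mul_of_nonneg_right (min_le_right _ _) hν.le)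
        (by positivity))
    refine h1.trans (le_of_eq ?_)
    field_simp
    ring
  have hfast' : 2 * B₀ / 2 < ‖u τ x‖ := by linarith
  have key := hG hν (by positivity : (0 : ℝ) < 2 * B₀) hcl hT'pos hT'T hbd hKKtop hL2 hbd0'
    τ ⟨hτ.1, hτT'⟩ hτw x hfast'
  refine key.trans (le_of_eq ?_)
  ring

/-! ### Corollary: the clean speed-gradient law on the fast set in the early window -/

/-- **Level-set dissipation law at margin zero (early window), log-free.** With the constants
`A, ε` of `levelSetModeration_fastSetGradient_logFree`: for every solution of the data class,
every level `c ≥ B₀` and every `t ≤ min T (εν/B₀²)`,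

  `∫₀ᵗ ∫ 1_{‖u‖>c} ‖∇‖u‖‖² ≤ (A B₀²/ν)² ∫₀ᵗ vol{‖u(τ)‖ > c} dτ`,

i.e. `ν² D_c(t) ≤ A² B₀⁴ V_c(t)` — the speed-gradient law implied by the crux
(`highSpeedPressureWork_speedGradientLaw`), proved unconditionally at margin zero for early
times (pointwise bound integrated over the fast set; `lintegral_indicator_const_le`,
`lintegral_const_mul'`). [folklore] -/
theorem levelSetModeration_fastSetDissipation_le :
    ∃ A ε : ℝ, 0 ≤ A ∧ 0 < ε ∧ ∀ (ν T : ℝ) (u : ℝ → EuclideanSpace ℝ (Fin 3) → EuclideanSpace ℝ (Fin 3)) (p : ℝ → EuclideanSpace ℝ (Fin 3) → ℝ), 0 < ν → 0 < T → Literature.Analysis.FluidPDE.IsClassicalNSSolutionOn (Set.Ico 0 T) ν 0 u p → Literature.Analysis.FluidPDE.IsLerayHopfOn T ν 0 (u 0) u → Literature.Analysis.FluidPDE.HasRapidSpatialDecay (u 0) → ∀ B₀ : ℝ, 0 < B₀ → (∀ x, ‖u 0 x‖ ≤ B₀) → ∀ (c t : ℝ), B₀ ≤ c → t ≤ T → t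 ≤ ε * ν / B₀ ^ 2 → (∫⁻ τ in Set.Ioo 0 t, ∫⁻ x, Set.indicator {x | c < ‖u τ x‖} (fun x => ENNReal.ofReal (‖fderiv ℝ (fun y => ‖u τ y‖) x‖ ^ 2)) x) ≤ ENNReal.ofReal ((A * (B₀ ^ 2 / ν)) ^ 2) * ∫⁻ τ in Set.Ioo 0 t, MeasureTheory.volume {x | c < ‖u τ x‖} := by
  obtain ⟨A, ε, hA0, hε, hG⟩ := levelSetModeration_fastSetGradient_logFree
  refine ⟨A, ε, hA0, hε, ?_⟩
  intro ν T u p hν hT hcl hLH hdec B₀ hB₀ hbd0 c t hc htT htε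
  set Kc : ℝ := A * (B₀ ^ 2 / ν) with hKc
  have hKc0 : 0 ≤ Kc := by rw [hKc]; positivity
  rw [← lintegral_const_mul' _ _ ENNReal.ofReal_ne_top]
  refine setLIntegral_mono' measurableSet_Ioo fun τ hτ => ?_
  have hτT : τ ∈ Ioo 0 T := ⟨hτ.1, hτ.2.trans_le htT⟩
  have hτε : τ ≤ ε * ν / B₀ ^ 2 := hτ.2.le.trans htε
  -- pointwise bound on the fast set, squared
  have hpt : ∀ x, c < ‖u τ x‖ →
      ENNReal.ofReal (‖fderiv ℝ (fun y => ‖u τ y‖) x‖ ^ 2) ≤ ENNReal.ofReal (Kc ^ 2) := by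
    intro x hx
    have h := hG ν T u p hν hT hcl hLH hdec B₀ hB₀ hbd0 τ hτT hτε x (hc.trans_lt hx)
    rw [← hKc] at h
    exact ENNReal.ofReal_le_ofReal (pow_le_pow_left₀ (norm_nonneg _) h 2)
  -- compare the indicators and integrate
  calc ∫⁻ x, Set.indicator {x | c < ‖u τ x‖}
        (fun x => ENNReal.ofReal (‖fderiv ℝ (fun y => ‖u τ y‖) x‖ ^ 2)) x
      ≤ ∫⁻ x, Set.indicator {x | c < ‖u τ x‖} (fun _ => ENNReal.ofReal (Kc ^ 2)) x := by
        refine lintegral_mono fun x => ?_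
        by_cases hx : x ∈ {x | c < ‖u τ x‖}
        · rw [indicator_of_mem hx, indicator_of_mem hx]
          exact hpt x hx
        · rw [indicator_of_notMem hx, indicator_of_notMem hx]
    _ ≤ ENNReal.ofReal (Kc ^ 2) * volume {x | c < ‖u τ x‖} := lintegral_indicator_const_le _ _

/-! ### Corollary: the iso-speed area law (first power of the gradient) in the early window -/

/-- **Iso-speed area law at margin zero in the early window.** With the constants `A, ε` of
`levelSetModeration_fastSetGradient_logFree`: for every solution of the data class, every level
`c ≥ B₀` and every `t ≤ min T (εν/B₀²)`,

  `∫₀ᵗ ∫ 1_{‖u‖>c} ‖∇‖u‖‖ ≤ (A B₀²/ν) ∫₀ᵗ vol{‖u(τ)‖ > c} dτ`,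

i.e. `ν 𝒟¹_c(t) ≤ A B₀² V_c(t)`: the line's open load `stub_isoSpeedAreaLaw` (the area /
viscous level-set law `ν𝒟¹_c ≤ Λ₁ M^{m₁} V_c`), which over the whole horizon is equivalent to the
class-uniform speed bound, holds UNCONDITIONALLY on the early window `(0, εν/B₀²)` at every level
down to the initial maximum (pointwise log-free bound integrated over the fast set). [folklore] -/
theorem levelSetModeration_fastSetArea_le :
    ∃ A ε : ℝ, 0 ≤ A ∧ 0 < ε ∧ ∀ (ν T : ℝ) (u : ℝ → EuclideanSpace ℝ (Fin 3) → EuclideanSpace ℝ (Fin 3)) (p : ℝ → EuclideanSpace ℝ (Fin 3) → ℝ), 0 < ν → 0 < T → Literature.Analysis.FluidPDE.IsClassicalNSSolutionOn (Set.Ico 0 T) ν 0 u p → Literature.Analysis.FluidPDE.IsLerayHopfOn T ν 0 (u 0) u → Literature.Analysis.FluidPDE.HasRapidSpatialDecay (u 0) → ∀ B₀ : ℝ, 0 < B₀ → (∀ x, ‖u 0 x‖ ≤ B₀) → ∀ (c t : ℝ), B₀ ≤ c → t ≤ T → t ≤ ε * ν / B₀ ^ 2 → (∫⁻ τ in Set.Ioo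 0 t, ∫⁻ x, Set.indicator {x | c < ‖u τ x‖} (fun x => ENNReal.ofReal ‖fderiv ℝ (fun y => ‖u τ y‖) x‖) x) ≤ ENNReal.ofReal (A * (B₀ ^ 2 / ν)) * ∫⁻ τ in Set.Ioo 0 t, MeasureTheory.volume {x | c < ‖u τ x‖} := by
  obtain ⟨A, ε, hA0, hε, hG⟩ := levelSetModeration_fastSetGradient_logFree
  refine ⟨A, ε, hA0, hε, ?_⟩
  intro ν T u p hν hT hcl hLH hdec B₀ hB₀ hbd0 c t hc htT htε
  set Kc : ℝ := A * (B₀ ^ 2 / ν) with hKc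
  rw [← lintegral_const_mul' _ _ ENNReal.ofReal_ne_top]
  refine setLIntegral_mono' measurableSet_Ioo fun τ hτ => ?_
  have hτT : τ ∈ Ioo 0 T := ⟨hτ.1, hτ.2.trans_le htT⟩
  have hτε : τ ≤ ε * ν / B₀ ^ 2 := hτ.2.le.trans htε
  have hpt : ∀ x, c < ‖u τ x‖ →
      ENNReal.ofReal ‖fderiv ℝ (fun y => ‖u τ y‖) x‖ ≤ ENNReal.ofReal Kc := by
    intro x hx
    have h := hG ν T u p hν hT hcl hLH hdec B₀ hB₀ hbd0 τ hτT hτε x (hc.trans_lt hx)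
    rw [← hKc] at h
    exact ENNReal.ofReal_le_ofReal h
  calc ∫⁻ x, Set.indicator {x | c < ‖u τ x‖} (fun x => ENNReal.ofReal ‖fderiv ℝ (fun y => ‖u τ y‖) x‖) x
      ≤ ∫⁻ x, Set.indicator {x | c < ‖u τ x‖} (fun _ => ENNReal.ofReal Kc) x := by
        refine lintegral_mono fun x => ?_
        by_cases hx : x ∈ {x | c < ‖u τ x‖}
        · rw [indicator_of_mem hx, indicator_of_mem hx]
          exact hpt x hx
        · rw [indicator_of_notMem hx, indicator_of_notMem hx]
    _ ≤ ENNReal.ofReal Kc * volume {x | c < ‖u τ x‖} := lintegral_indicator_const_le _ _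

end Summit.NavierStokesRegularity.NavierStokesRegularity.Theorems

end
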